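import Literature.MathematicalPhysics.QuantumFieldTheory.Balaban1983to89.B3Ineq210MixedTorus
import Literature.MathematicalPhysics.QuantumFieldTheory.Balaban1983to89.B3Ineq313Pointwise
import Literature.MathematicalPhysics.QuantumFieldTheory.Balaban1983to89.B3Bound323ZeroTorus

/-!
# `Balaban1983to89.B3Sect3KernelsZeroTorus` — T. Bałaban, *(Higgs)₂,₃ quantum fields in a finite volume. III. Renormalization*, Commun.
Math. Phys. **88** (1983) 411–445 [Balaban1983Higgs3]: the (2.10)-type KERNEL HYPOTHESES of the Sect. 3 estimates — p. 436 (3.13)/(3.14)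
*"(the expression (3.12)) ≦ O(1) Σ … (L^jη)^{−d} e^{−δ₀(L^jη)^{−1}dist} (L^{j′}η)^{−d+2} e^{…} …"* — DISCHARGED at the zero-field TORUS MODEL
INSTANCE `A = B̃ = 0`, `Ω = T_η` (p03's `B3Ineq210ZeroTorus`, p20's `B3Ineq210MixedTorus`), with the dictionary between the two torus
distances of the tree (`B5Ineq137Torus.T` = `LatticeFieldCalculus.supDist` ≤ `Setup.Site.tdist` ≤ `d·supDist`)

statement-level skeleton of published theorems with citation tags; proofs where landed; nothing here is a claim about the Yang–Mills mass gap

PDF held: `paper:balaban1983-higgs-2-3-quantum-fields-finite-volume` (journal page = PDF page + 410); pp. 426 [PDF 16], 435–436 [PDF 25–26].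

CITATION HEADER (lean-in-tree rule).  Part of the lit-balaban TYPED SKELETON (HOME `run/shared/lean/pub/lit-balaban/`), Phase 2, seat p20
generation 5: rows **B3.Eq3.11-3.17** (the kernel inputs of (3.13)/(3.14)) and **B3.Eq2.10** (torus model instance) of
`HOME/lit-balaban-r15/ROWS-B3.md` (fold owner r15).  Consumes BY NAME: r15's `B3Sect3ScalarSelfEnergy` ((3.9): `Kernel`, `dKernel`, `coeff39`),
p20 g2's `B3Ineq313Pointwise` (`term312`, `abs_term312_le`), p03 g4's `B3Ineq210ZeroTorus` (`pieceT`, `zeroTorusKernels`, `ineq210_zeroTorus`),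
p20 g5's `B3Ineq210MixedTorus` (`mixedT`, `ineq210_mixed_zeroTorus`), p39 g5's `B3Bound323ZeroTorus` (`T_eq_supDist`), the torus distance
`B5Ineq137Torus.T`; nothing re-proved.

WHAT IS TYPED / PROVED, and how.  §1 DISTANCE DICTIONARY (two conventions coexist in the tree): the sup torus distance `T P j x y` of the B4/B5
torus lineage (`B4Sect5Torus.tdist` through `toT`, real-valued) EQUALS `LatticeFieldCalculus.supDist x y` (p39 g5's landed
`B3Bound323ZeroTorus.T_eq_supDist`, reused by name), and `Site.tdist ≤ d·supDist` (private `tdist_le_mul_supDist`;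
`Setup.Site.tdist` = the `ℓ¹` torus distance used by the Sect. 3 files); hence a decay `e^{−δ·εT/s}` is a decay `e^{−(δ/d)·ε|x−x′|₁/s}` (`exp_T_le_exp_tdist`).  §2 THE PROPAGATOR PIECES AS SECT.-3 KERNELS:
`gpiece P a msq k j : Kernel P 0` = `η^{−d}·pieceT j` (p03's `absG`); the pieces are SYMMETRIC kernels (`pieceT_symm`, from `Grs_isSymm`,
`Carg_isSymm`, `blockOp_isSymm` and `(Q_jG_j^{resc})ᵀ = L^{−jd}G_j^{resc}Q_j^*`), and r15's four kernel operations on them are p03's/p20's matrix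
quantities: `dKernel_gpiece`/`d2Kernel_gpiece` (= `η^{−d}·mixedT`), `d1Kernel_gpiece` (= `η^{−d}·(∂^ε_μ·pieceT)`), `dAdjKernel_gpiece` (the column
difference = the row difference at swapped arguments, by symmetry).  §3 THE HYPOTHESES DISCHARGED, uniformly in the volume and the scales:
**`gpiece_bounds`** — ∃ δ, C > 0 (functions of `d, L, a, m²`) such that for every volume `P` (these `d, L`), every `1 ≤ k ≤ K`, all `j`,
directions, sites: `|gpiece j(x,x′)| ≤ C(L^jη)^{2−d}e^{−δ(L^jη)^{−1}(η|x−x′|₁)}` (value), `|d1Kernel|, |dAdjKernel| ≤ C(L^jη)^{1−d}e^{…}` (one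
difference), `|d2Kernel μ′ μ| ≤ C(L^jη)^{−d}e^{…}` (one difference in each variable) — i.e. hGj/hGj′ of `abs_term312_le`, hA/hA′/hB/hB′ of
`abs_curly2_le`, the hM/hG-type inputs of (3.16).  §4 **(3.13)/(3.14) AT THE ZERO-FIELD TORUS INSTANCE** `abs_term312_le_zeroTorus`: for the
expression (3.12) built on the ACTUAL propagator pieces `G_{(j)}(0) = gpiece j`, `G_{(j′)} = gpiece j′` of Bałaban's scalar torus tower, p20 g2's
bound holds with these `δ, C` — the only remaining hypotheses are those on the legs/vertices
(`|g|, |g′| ≤ 1`, `‖qw‖ ≤ Q‖w‖`, the Hölder-α leg `φ′`).  HONEST SCOPE = that of `B3Ineq210ZeroTorus` (A = B̃ = 0, U ≡ 1, whole torus, fixed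
`a > 0`, `m² ≥ 0`, existential constants); both kernels of (3.9) are scale pieces (2.6) of the reduced propagator `G_k(0)` of p. 433 (*"Finally we replace the scalar
field propagator G_k(□,0) by G_k(0)"*), modelled here by the zero-field torus tower.  D-0026: no named fact (`gpiece` is a `def` with body); standard axioms.
Unit `lit-balaban-p20` (literature-prover-lit-balaban-p20-g5-0), 2026-08-21.
-/

namespace Literature.MathematicalPhysics.QuantumFieldTheory.Balaban1983to89.B3Sect3KernelsZeroTorus

open Matrix B1RG242Torus B5Display136Torus B5Leaf237C0Torus B4Ineq115Torus B5Ineq137Torus B4Ineq116Torus B4Thm110ZeroTorus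
open B3Ineq210ZeroTorus B3Ineq210MixedTorus
open LatticeFieldCalculus B3Sect3ScalarSelfEnergy B3Taylor310Remainder B3Ineq313Pointwise

noncomputable section

/-! ## §1 The two torus distances of the tree: `T = supDist`, `tdist ≤ d·supDist` -/

section Distances

variable {P : Params} {j : ℕ}

/-- `ℓ¹ ≤ d·ℓ^∞`: `Site.tdist x y ≤ d·supDist x y`. [folklore] -/
private theorem tdist_le_mul_supDist (x y : Site P j) : Site.tdist x y ≤ P.d * supDist x y := by
  unfold supDist Site.tdist
  calc ∑ μ : Fin P.d, min (x μ - y μ).val (y μ - x μ).val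
      ≤ ∑ _μ : Fin P.d, Finset.univ.sup (fun μ : Fin P.d => min (x μ - y μ).val (y μ - x μ).val) :=
        Finset.sum_le_sum fun μ _ => Finset.le_sup (f := fun μ => min (x μ - y μ).val (y μ - x μ).val) (Finset.mem_univ μ)
    _ = P.d * _ := by rw [Finset.sum_const, Finset.card_univ, Fintype.card_fin, smul_eq_mul]

/-- A decay in the sup torus distance is a decay, at rate `δ/d`, in the `ℓ¹` torus distance of the Sect. 3 files:
`e^{−δ·c·T(x,x′)} ≤ e^{−(δ/d)·c·|x−x′|₁}` (`δ, c ≥ 0`). [cite: Balaban1983Higgs3, (2.10) p.426] -/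
theorem exp_T_le_exp_tdist {δ c : ℝ} (hδ : 0 ≤ δ) (hc : 0 ≤ c) (x x' : Site P 0) :
    Real.exp (-(δ * c * T P 0 x x')) ≤ Real.exp (-(δ / P.d * c * (Site.tdist x x' : ℝ))) := by
  have hd : (0 : ℝ) < P.d := by exact_mod_cast P.hd
  rw [Real.exp_le_exp, neg_le_neg_iff, B3Bound323ZeroTorus.T_eq_supDist P]
  have h : (Site.tdist x x' : ℝ) ≤ P.d * (supDist x x' : ℝ) := by exact_mod_cast tdist_le_mul_supDist x x'
  calc δ / P.d * c * (Site.tdist x x' : ℝ) ≤ δ / P.d * c * (P.d * (supDist x x' : ℝ)) :=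
        mul_le_mul_of_nonneg_left h (by positivity)
    _ = δ * c * (supDist x x' : ℝ) := by field_simp

end Distances

/-! ## §2 The zero-field torus propagator pieces as Sect.-3 kernels -/

section Pieces

variable (P : Params)

/-- The scale piece `G^η_{(j)}(x,x′)` of the zero-field torus tower AS A SECT.-3 KERNEL (r15's `Kernel P 0`, i.e. w.r.t. the `η^d`-weighted
sums `Σ_{x′} η^d K(x,x′)f(x′)` of (3.9)): `η^{−d}·pieceT j` (`η = ε`; p03's normalisation `absG = η^{−d}|piece|`).
[cite: Balaban1983Higgs3, (2.6) p.424, (3.9) p.435] -/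
def gpiece (a msq : ℝ) (k j : ℕ) : Kernel P 0 := fun x x' => (P.eps ^ P.d)⁻¹ * pieceT P a msq k j x x'

variable {P}

/-- The (3.9) kernel `(∂^η_μ G_{(j)} ∂^{η*}_μ)(x,x′)` of the piece is `η^{−d}` times its twice-differentiated matrix `mixedT`.
[cite: Balaban1983Higgs3, (3.9) p.435, (2.10) p.426] -/
theorem dKernel_gpiece (a msq : ℝ) (k j : ℕ) (μ : Fin P.d) (x x' : Site P 0) :
    dKernel (P.eps)⁻¹ μ (gpiece P a msq k j) x x' = (P.eps ^ P.d)⁻¹ * mixedT P P.eps μ μ (pieceT P a msq k j) x x' := by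
  rw [mixedT_apply]
  unfold dKernel gpiece
  ring

/-- The (3.26) kernel `(∂^η_{μ′} G ∂^{η*}_μ)(x,x′)` of the piece (r15's `B3Sect3VectorSelfEnergy.d2Kernel`) is `η^{−d}·mixedT_{μ′μ}`.
[cite: Balaban1983Higgs3, (3.26) p.440, (2.10) p.426] -/
theorem d2Kernel_gpiece (a msq : ℝ) (k j : ℕ) (μ' μ : Fin P.d) (x x' : Site P 0) :
    B3Sect3VectorSelfEnergy.d2Kernel (P.eps)⁻¹ μ' μ (gpiece P a msq k j) x x' =
      (P.eps ^ P.d)⁻¹ * mixedT P P.eps μ' μ (pieceT P a msq k j) x x' := by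
  rw [mixedT_apply]
  unfold B3Sect3VectorSelfEnergy.d2Kernel gpiece
  ring

/-- The (3.23) kernel `(∂^η_μ G)(x,x′)` of the piece (r15's `d1Kernel`, row difference) is `η^{−d}·(∂^ε_μ·pieceT)(x,x′)` (p03's `absDG`).
[cite: Balaban1983Higgs3, (3.23) p.439, (2.10) p.426] -/
theorem d1Kernel_gpiece (a msq : ℝ) (k j : ℕ) (μ : Fin P.d) (x x' : Site P 0) :
    d1Kernel (P.eps)⁻¹ μ (gpiece P a msq k j) x x' =
      (P.eps ^ P.d)⁻¹ * (deriv P 0 P.eps μ * pieceT P a msq k j) x x' := by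
  rw [B5Leaf235Torus.deriv_mul_apply]
  unfold d1Kernel gpiece
  ring

/-- kernel: the fluctuation covariance `C^{(j)} = (Carg)⁻¹` is symmetric (`B4Ineq115Torus.Carg_isSymm`). [folklore] -/
private theorem Crs_isSymm (a msq : ℝ) (j : ℕ) : (Crs P a msq j).IsSymm := by
  rw [Crs_eq P a msq j]
  unfold Matrix.IsSymm
  rw [Matrix.transpose_nonsing_inv, (Carg_isSymm (P := P) a msq j).eq]

/-- kernel: the `C^{(0)}` kernel `G_0^{unit} = (blockOp)⁻¹` is symmetric (`B5Leaf237C0Torus.blockOp_isSymm`). [folklore] -/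
private theorem G0unit_isSymm (a msq : ℝ) : (G0unit P a msq).IsSymm := by
  rw [G0unit_eq]
  unfold Matrix.IsSymm
  rw [Matrix.transpose_nonsing_inv, (blockOp_isSymm (P := P) 0 1 (lvl P 1) (P.eps ^ 2 * msq) (a * ((P.L : ℝ) ^ 2)⁻¹)).eq]

/-- kernel: a term of (2.34) is a symmetric kernel: `(G^{resc}Q^*)C^{(j)}(QG^{resc})` with `(QG^{resc})ᵀ = L^{−jd}G^{resc}Q^*` and `C^{(j)}`
symmetric. [cite: Balaban1983RegularityDecay, (2.34) p.582] -/
theorem term_symm {a msq : ℝ} (ha : 0 < a) (hm : 0 ≤ msq) {j : ℕ} (hj1 : 1 ≤ j) (hj : j ≤ P.m + P.K) (x x' : Site P 0) :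
    (tower P a msq).term j x x' = (tower P a msq).term j x' x := by
  rw [term_apply ha hm hj1, term_apply ha hm hj1]
  refine congrArg (HMul.hMul (B1.aSeq a P.L j ^ 2 * P.spacing j ^ 2)) ?_
  simp_rw [QkGrs_apply P hj]
  rw [Finset.sum_comm]
  refine Finset.sum_congr rfl fun y' _ => Finset.sum_congr rfl fun y _ => ?_
  rw [(Crs_isSymm (P := P) a msq j).apply y' y]
  ring

/-- **The scale pieces `G^η_{(j)}` of the zero-field torus tower are symmetric kernels**, `G_{(j)}(x,x′) = G_{(j)}(x′,x)`.
[cite: Balaban1983Higgs3, (2.6) p.424] -/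
theorem pieceT_symm {a msq : ℝ} (ha : 0 < a) (hm : 0 ≤ msq) {k : ℕ} (hkm : k ≤ P.m + P.K) (j : ℕ) (x x' : Site P 0) :
    pieceT P a msq k j x x' = pieceT P a msq k j x' x := by
  rcases Nat.eq_zero_or_pos j with rfl | hj1
  · rw [pieceT_zero, G_one_eq_smul_G0unit (P := P) ha hm, Matrix.smul_apply, Matrix.smul_apply,
      (G0unit_isSymm (P := P) a msq).apply x x']
  · rcases Nat.lt_or_ge j k with hjk | hkj
    · rw [pieceT_of_pos hj1 hjk]
      exact term_symm ha hm hj1 (hjk.le.trans hkm) x x'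
    · rw [pieceT_of_le hj1 hkj, Matrix.zero_apply, Matrix.zero_apply]

/-- The (3.26) kernel `(G∂^{η*}_μ)(y,x′)` of the piece (r15's `dAdjKernel`, column difference) is, by the symmetry of the piece, the ROW
difference at the swapped arguments: `η^{−d}·(∂^ε_μ·pieceT)(x′,y)`. [cite: Balaban1983Higgs3, (3.26) p.440, (2.10) p.426] -/
theorem dAdjKernel_gpiece {a msq : ℝ} (ha : 0 < a) (hm : 0 ≤ msq) {k : ℕ} (hkm : k ≤ P.m + P.K) (j : ℕ) (μ : Fin P.d)
    (y x' : Site P 0) :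
    B3Sect3VectorSelfEnergy.dAdjKernel (P.eps)⁻¹ μ (gpiece P a msq k j) y x' =
      (P.eps ^ P.d)⁻¹ * (deriv P 0 P.eps μ * pieceT P a msq k j) x' y := by
  rw [B5Leaf235Torus.deriv_mul_apply]
  unfold B3Sect3VectorSelfEnergy.dAdjKernel gpiece
  rw [pieceT_symm ha hm hkm j y (Site.shift x' μ), pieceT_symm ha hm hkm j y x']
  ring

end Pieces

/-! ## §3 The kernel hypotheses of (3.13)/(3.14) discharged at the zero-field torus instance -/

section Bounds

universe u

/-- kernel: the `ℓ¹` torus distance is symmetric. [folklore] -/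
private theorem tdist_comm' {P : Params} (x y : Site P 0) : Site.tdist x y = Site.tdist y x := by
  unfold Site.tdist
  exact Finset.sum_congr rfl fun μ _ => min_comm _ _

/-- kernel: a decay at a rate `δ′ ≥ m` in `εT/s` is a decay at rate `m/d` in `ε|x−x′|₁/s`. [folklore] -/
private theorem exp_rate_T_le {P : Params} {m δ' s : ℝ} (hm : 0 ≤ m) (hmδ : m ≤ δ') (hs : 0 < s) (x x' : Site P 0) :
    Real.exp (-(δ' * s⁻¹ * (P.eps * T P 0 x x'))) ≤
      Real.exp (-(m / P.d * s⁻¹ * (P.eps * (Site.tdist x x' : ℝ)))) := by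
  have hε := P.eps_pos
  have hT := T_nonneg P 0 x x'
  have h1 : Real.exp (-(δ' * s⁻¹ * (P.eps * T P 0 x x'))) ≤ Real.exp (-(m * (s⁻¹ * P.eps) * T P 0 x x')) := by
    rw [Real.exp_le_exp, neg_le_neg_iff]
    have : 0 ≤ s⁻¹ * P.eps * T P 0 x x' := by positivity
    nlinarith
  refine h1.trans ?_
  have h2 := exp_T_le_exp_tdist (δ := m) (c := s⁻¹ * P.eps) hm (by positivity) x x'
  refine h2.trans (le_of_eq ?_)
  congr 1
  ring

/-- **The (2.10)-type kernel hypotheses of the Sect. 3 estimates DISCHARGED at the zero-field torus model instance**, uniformly in the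
volume and the scales, in the SHAPES the Sect. 3 files consume (`ℓ¹` torus distance `η·Site.tdist`, real powers of `s = L^jη`): there are
`δ, C > 0` (functions of `d, L, a, m²`) such that for every volume `P` of Bałaban's scalar torus tower with these `d, L`, every scale
`1 ≤ k ≤ K` and all `j`, directions and sites: (value, (2.10)) `|G_{(j)}(x,x′)| ≤ C(L^jη)^{2−d}e^{−δ(L^jη)^{−1}|x−x′|}` — hGj′ of
`abs_term312_le`, hB of `abs_curly2_le`; (row difference) `|(∂^η_μG_{(j)})(x,x′)| ≤ C(L^jη)^{1−d}e^{…}`; (column difference, by symmetry)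
`|(G_{(j)}∂^{η*}_μ)(y,x′)| ≤ C(L^jη)^{1−d}e^{…}` — hA/hA′ of `abs_curly2_le`; (one difference in each variable, `B3Ineq210MixedTorus`)
`|(∂^η_{μ′}G_{(j)}∂^{η*}_μ)(x,x′)| ≤ C(L^jη)^{−d}e^{…}` — hGj of `abs_term312_le`, hB′ of `abs_curly2_le`, hM-type inputs of (3.16).
Sources: p03's `B3Ineq210ZeroTorus.ineq210_zeroTorus` (value + row difference), p20's `ineq210_mixed_zeroTorus_rpow`, `pieceT_symm`.
[cite: Balaban1983Higgs3, (2.10) p.426, (3.13) p.436] -/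
theorem gpiece_bounds (d L : ℕ) (hd : 1 ≤ d) (hL : Odd L ∧ 1 < L) {a : ℝ} (ha : 0 < a) {msq : ℝ} (hmsq : 0 ≤ msq) :
    ∃ δ C : ℝ, 0 < δ ∧ 0 < C ∧ ∀ (P : Params), P.d = d → P.L = L →
      ∀ k : ℕ, 1 ≤ k → k ≤ P.K →
        (∀ (j : ℕ) (x x' : Site P 0),
          |gpiece P a msq k j x x'| ≤
            C * P.spacing j ^ ((2 : ℝ) - (P.d : ℝ)) * Real.exp (-(δ * (P.spacing j)⁻¹ * (P.eps * (Site.tdist x x' : ℝ))))) ∧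
        (∀ (j : ℕ) (μ : Fin P.d) (x x' : Site P 0),
          |d1Kernel (P.eps)⁻¹ μ (gpiece P a msq k j) x x'| ≤
            C * P.spacing j ^ ((1 : ℝ) - (P.d : ℝ)) * Real.exp (-(δ * (P.spacing j)⁻¹ * (P.eps * (Site.tdist x x' : ℝ))))) ∧
        (∀ (j : ℕ) (μ : Fin P.d) (y x' : Site P 0),
          |B3Sect3VectorSelfEnergy.dAdjKernel (P.eps)⁻¹ μ (gpiece P a msq k j) y x'| ≤
            C * P.spacing j ^ ((1 : ℝ) - (P.d : ℝ)) * Real.exp (-(δ * (P.spacing j)⁻¹ * (P.eps * (Site.tdist y x' : ℝ))))) ∧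
        (∀ (j : ℕ) (μ' μ : Fin P.d) (x x' : Site P 0),
          |B3Sect3VectorSelfEnergy.d2Kernel (P.eps)⁻¹ μ' μ (gpiece P a msq k j) x x'| ≤
            C * P.spacing j ^ (-(P.d : ℝ)) * Real.exp (-(δ * (P.spacing j)⁻¹ * (P.eps * (Site.tdist x x' : ℝ))))) := by
  obtain ⟨δ₁, C₁, hδ₁, hC₁, h1⟩ := ineq210_mixed_zeroTorus_rpow d L hd hL ha hmsq
  obtain ⟨δ₂, C₂, hδ₂, hC₂, h2⟩ := ineq210_zeroTorus d L hd hL ha hmsq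
  have hm : 0 < min δ₁ δ₂ := lt_min hδ₁ hδ₂
  refine ⟨min δ₁ δ₂ / d, max C₁ C₂, div_pos hm (by exact_mod_cast hd), lt_max_of_lt_left hC₁, ?_⟩
  intro P hPd hPL k hk1 hkK
  have hkm : k ≤ P.m + P.K := hkK.trans (Nat.le_add_left _ _)
  have hdP : (min δ₁ δ₂ / d : ℝ) = min δ₁ δ₂ / P.d := by rw [hPd]
  have hεd : 0 ≤ (P.eps ^ P.d)⁻¹ := by have := P.eps_pos; positivity
  -- p03's carrier unpacked: `absG = η^{−d}|piece|`, `absDG = η^{−d}|∂piece|`, `scale = L^jη`, `dist = η·T`, `S.d = P.d`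
  have hval : ∀ (j : ℕ) (x x' : Site P 0), (P.eps ^ P.d)⁻¹ * |pieceT P a msq k j x x'| ≤
      C₂ * P.spacing j ^ ((2 : ℝ) - (P.d : ℝ)) * Real.exp (-(δ₂ * (P.spacing j)⁻¹ * (P.eps * T P 0 x x'))) :=
    fun j x x' => (h2 P hPd hPL k hk1 hkK j x x').1
  have hder : ∀ (j : ℕ) (μ : Fin P.d) (x x' : Site P 0), (P.eps ^ P.d)⁻¹ * |(deriv P 0 P.eps μ * pieceT P a msq k j) x x'| ≤
      C₂ * P.spacing j ^ ((1 : ℝ) - (P.d : ℝ)) * Real.exp (-(δ₂ * (P.spacing j)⁻¹ * (P.eps * T P 0 x x'))) :=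
    fun j μ x x' => (h2 P hPd hPL k hk1 hkK j x x').2 μ
  -- enlarging the constant and passing from `T` to the `ℓ¹` distance
  have fin : ∀ {v C' δ' p : ℝ} (j : ℕ) (x x' : Site P 0), C' ≤ max C₁ C₂ → min δ₁ δ₂ ≤ δ' → 0 ≤ v →
      v ≤ C' * P.spacing j ^ p * Real.exp (-(δ' * (P.spacing j)⁻¹ * (P.eps * T P 0 x x'))) →
      v ≤ max C₁ C₂ * P.spacing j ^ p *
        Real.exp (-(min δ₁ δ₂ / d * (P.spacing j)⁻¹ * (P.eps * (Site.tdist x x' : ℝ)))) := by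
    intro v C' δ' p j x x' hC' hδ' hv hb
    have hsp : 0 < P.spacing j ^ p := Real.rpow_pos_of_pos (P.spacing_pos j) _
    have hC'0 : 0 ≤ C' := by
      have := hv.trans hb
      exact nonneg_of_mul_nonneg_left (nonneg_of_mul_nonneg_left this (Real.exp_pos _)) hsp
    rw [hdP]
    calc v ≤ C' * P.spacing j ^ p * Real.exp (-(δ' * (P.spacing j)⁻¹ * (P.eps * T P 0 x x'))) := hb
      _ ≤ max C₁ C₂ * P.spacing j ^ p *
          Real.exp (-(min δ₁ δ₂ / P.d * (P.spacing j)⁻¹ * (P.eps * (Site.tdist x x' : ℝ)))) :=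
        mul_le_mul (mul_le_mul_of_nonneg_right hC' hsp.le) (exp_rate_T_le hm.le hδ' (P.spacing_pos j) x x')
          (Real.exp_pos _).le (by positivity)
  refine ⟨fun j x x' => ?_, fun j μ x x' => ?_, fun j μ y x' => ?_, fun j μ' μ x x' => ?_⟩
  · -- value
    have hv : |gpiece P a msq k j x x'| = (P.eps ^ P.d)⁻¹ * |pieceT P a msq k j x x'| := by
      unfold gpiece; rw [abs_mul, abs_of_nonneg hεd]
    rw [hv]
    exact fin j x x' (le_max_right _ _) (min_le_right _ _) (by positivity) (hval j x x')
  · -- row difference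
    rw [d1Kernel_gpiece, abs_mul, abs_of_nonneg hεd]
    exact fin j x x' (le_max_right _ _) (min_le_right _ _) (by positivity) (hder j μ x x')
  · -- column difference: the row difference at the swapped arguments, `T` and `tdist` symmetric
    rw [dAdjKernel_gpiece ha hmsq hkm, abs_mul, abs_of_nonneg hεd, tdist_comm' y x']
    have hb := hder j μ x' y
    exact fin j x' y (le_max_right _ _) (min_le_right _ _) (by positivity) hb
  · -- one difference in each variable
    rw [d2Kernel_gpiece, abs_mul, abs_of_nonneg hεd]
    exact fin j x x' (le_max_left _ _) (min_le_left _ _) (by positivity) (h1 P hPd hPL k hk1 hkK j μ' μ x x')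

/-- **(3.13)/(3.14) p. 436 AT THE ZERO-FIELD TORUS MODEL INSTANCE — the kernel hypotheses discharged.**  For the expression (3.12) (`term312`)
built on the ACTUAL propagator pieces `G_{(j)}(0) = gpiece j`, `G_{(j′)} = gpiece j′` of Bałaban's scalar torus tower (`A = B̃ = 0`, `Ω = T_η`,
`η = ε`), p20 g2's pointwise estimate `abs_term312_le` holds with constants `δ, C` depending on `d, L, a, m²` only — for every volume,
every scale `1 ≤ k ≤ K` and all line indices `j, j′`: `|(3.12)| ≤ 2dC₁C₂Q²H(2/δ+8/δ²)(m·m^α)Σ_{x,x′}η^{2d}‖φ(x)‖(L^jη)^{−d}e^{−½δ|x−x′|/L^jη}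
(L^{j′}η)^{2−d}e^{−½δ|x−x′|/L^{j′}η}`, `m = min(L^jη, L^{j′}η)`; the only remaining hypotheses are the printed ones on the vertices and legs
(`|g|,|g′| ≤ 1`, `‖qw‖ ≤ Q‖w‖`, the Hölder-α leg `φ′`).  The cube-localized printed form then follows by p20 g5's
`B3Ineq314Cubes.sum_sum_le_cubes`. [cite: Balaban1983Higgs3, (3.13)/(3.14) p.436] -/
theorem abs_term312_le_zeroTorus (d L : ℕ) (hd : 1 ≤ d) (hL : Odd L ∧ 1 < L) {a : ℝ} (ha : 0 < a) {msq : ℝ}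
    (hmsq : 0 ≤ msq) :
    ∃ δ C : ℝ, 0 < δ ∧ 0 < C ∧ ∀ (P : Params), P.d = d → P.L = L →
      ∀ k : ℕ, 1 ≤ k → k ≤ P.K → ∀ (j j' : ℕ)
        {W : Type u} [NormedAddCommGroup W] [InnerProductSpace ℝ W]
        {α H Q : ℝ}, 0 ≤ α → α ≤ 1 → 0 ≤ H → 0 ≤ Q →
        ∀ (q : W →ₗ[ℝ] W), (∀ w : W, ‖q w‖ ≤ Q * ‖w‖) →
        ∀ (g g' : SiteField P 0 ℝ), (∀ x, |g x| ≤ 1) → (∀ x, |g' x| ≤ 1) →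
        ∀ (φ φ' : SiteField P 0 W), HolderDeriv (P.eps)⁻¹ α H φ' →
          |term312 P.eps q (gpiece P a msq k j) (gpiece P a msq k j') g g' φ φ'| ≤
            2 * P.d * C * C * Q ^ 2 * H * (2 / δ + 8 / δ ^ 2) *
              (min (P.spacing j) (P.spacing j') * (min (P.spacing j) (P.spacing j')) ^ α) *
              ∑ x : Site P 0, ∑ x' : Site P 0, P.eps ^ (2 * P.d) *
                (‖φ x‖ * (P.spacing j ^ (-(P.d : ℝ)) *
                    Real.exp (-(δ / 2 * (P.spacing j)⁻¹ * (P.eps * Site.tdist x x'))))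
                  * (P.spacing j' ^ ((2 : ℝ) - (P.d : ℝ)) *
                    Real.exp (-(δ / 2 * (P.spacing j')⁻¹ * (P.eps * Site.tdist x x'))))) := by
  obtain ⟨δ, C, hδ, hC, h⟩ := gpiece_bounds d L hd hL ha hmsq
  refine ⟨δ, C, hδ, hC, ?_⟩
  intro P hPd hPL k hk1 hkK j j' W _ _ α H Q hα0 hα1 hH hQ q hq g g' hg hg' φ φ' hφ'
  obtain ⟨hv, -, -, hmix⟩ := h P hPd hPL k hk1 hkK
  exact abs_term312_le P.eps P.eps_pos hα0 hα1 hH hQ hδ (P.spacing_pos j) (P.spacing_pos j') q hq _ _ g g' hg hg'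
    (fun μ x x' => hmix j μ μ x x') (hv j') φ φ' hφ'

end Bounds

end

end Literature.MathematicalPhysics.QuantumFieldTheory.Balaban1983to89.B3Sect3KernelsZeroTorus
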